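import Literature.NumberTheory.Automorphic.SymplecticSatakeInjective
import Literature.NumberTheory.Automorphic.HyperspecialUnitaryCartanIwasawaUniqueness
import HarnessLib

/-!
# Bruhat–Tits (4.4.4) (ii) for `Sp_{2n}`: the coset `d(a) K₀` is the only coset of `K₀ d(a) K₀` with Iwasawa exponents
# `a`, and the Satake transform of `ℋ(Sp_{2n}(K), Sp_{2n}(𝒪); R)` is injective over EVERY commutative ring `R`

[topic NumberTheory/Automorphic] — lane `lit-hodgefound`, seat p11, generation 43, self-proposed theorem-only row g43-#6
(the `Sp_{2n}` counterpart of `CartanIwasawaUniquenessGL` (g42-#1) and `HyperspecialUnitaryCartanIwasawaUniqueness`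
(g43-#3); successor pointer (s2) of generation 42, done directly in the `Valued K ℤᵐ⁰` world, no gluing to `GL_{2n}`).

## The print

Bruhat–Tits, Prop. (4.4.4) (p. 80): for a good maximal compact `K`, `t ∈ Z⁺`: «(i) Si `K.t.K ∩ B̂⁰.t′.K ≠ ∅`, on a `t′ ≤ t`.
(ii) On a `K.t.K ∩ B̂⁰.t.K = t.K`.»  Cartier, §IV, proof of Thm. 4.1, step (c): the Satake transform of the characteristic
function `c_λ` of `K λ(ϖ) K` is `∑_{μ ≤ λ} c(λ, μ) · μ` with `c(λ, λ) = δ(λ)^{1/2} ≠ 0` — (ii) is exactly the statement that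
ONE coset of `KtK` has the extreme Iwasawa component, so that `c(λ, λ)` is the weight of `λ`, a unit.  For `Sp_{2n}` with the
tree's conventions (`SymplecticGroupIwasawa`, `SymplecticGroupIwasawaExponents`): `K₀ = Sp(J, 𝒪)`, `B` upper triangular
for the Borel order `inr 0 < ⋯ < inr (n-1) < inl (n-1) < ⋯ < inl 0`, `a(g)ᵢ = ord p_{inl i, inl i}` for `g = p k`, Cartan
representatives `d(a) = diag(ϖ^{a}; ϖ^{-a})`, `a` antitone in `ℕⁿ` (Andrianov–Zhuravlev Ch. 3 §3 Lemma 3.6); (i) is the tree's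
`sum_symplecticIwasawaExp_head_le` (`Σ_{i<r} a(γ)ᵢ ≤ Σ_{i<r} aᵢ` on `K₀ d(a) K₀`), and the tree's injectivity
`symplecticSatakeTransform_injective` needed `R` a domain of characteristic `0` because only `#{γ : a(γ) = a} ≥ 1` was known.

## What is formalised (kernel path: theorems only, no new definitions, no named facts)

* §1 linear algebra: **`toBlocks₁₁_mul_transpose_toBlocks₂₂_eq_one`** — for `M ∈ Sp(J)` with vanishing `(inl, inr)`-block,
  `M₁₁ M₂₂ᵀ = 1` (block multiplication of `M J Mᵀ = J`); `v_inv_apply_le_one_of_v_det_eq_one` (integral matrix with unit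
  determinant valuation has integral inverse, adjugate); `sum_ite_lt_succ_eq`.
* §2 `det_submatrix_inr_snoc_of_mem_symplecticBorel`: for `p ∈ B(K)` the minor on rows `inr 0..i`, columns `inr 0..i-1, y` is
  `(∏_{l<i} p_{inr l, inr l}) p_{inr i, y}`.
* §3 **(4.4.4) (ii)**: `v_apply_inr_le_of_symplecticIwasawaExp_eq` (entry bound `|p_{inr i, y}| ≤ exp(aᵢ)` from the minors of
  `p ∈ K₀ d(a) K₀` — `v_minor_le_of_eq_mul_diagonal_mul`, `prod_v_cartanDiagonal_le` of `SymplecticIwasawaCartan`),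
  **`coe_eq_coe_cartanDiagonal_of_symplecticIwasawaExp_eq`** (`gK₀ ⊆ K₀d(a)K₀`, `a(g) = a` ⟹ `gK₀ = d(a)K₀`: `w = d(a)⁻¹p` has
  integral `inr`-rows, unit `inr`-diagonal, and `inl`-block `= (w₂₂ᵀ)⁻¹` integral, so `w ∈ K₀`),
  `eq_coe_cartanDiagonal_of_mem_orbit_of_symplecticIwasawaExp_out_eq`, `eq_coe_of_mem_orbit_cartanDiagonal` ((UNIQUENESS) in
  the shape of the abstract criterion).
* §4 **`satakeTransform_symplectic_injective_of_commRing`**: `(isIwasawaExponent_symplectic hϖ).satakeTransform w` is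
  injective for EVERY weight `w` and EVERY commutative ring `R` (criterion `IsIwasawaExponent.satakeTransform_injective_of_unique`
  of `CartanIwasawaUniquenessGL` §3); **`symplecticSatakeTransform_injective_of_commRing`** (the weight `q^{⟨ρ, ·⟩}`);
  `eq_zero_of_satakeTransform_symplectic_eq_zero`.
* §5 (Hecke pair): `card_filter_symplecticIwasawaExp_orbit_eq_one` (`#{γ ⊆ K₀d(a)K₀ : a(γ) = a} = 1`),
  **`coeff_self_satakeTransform_symplectic_cartanDiagonal`** (the coefficient of `x^a` in `𝒮_w(T_{d(a)})` is `w(a)`),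
  `coeff_self_symplecticSatakeTransform_cartanDiagonal` (`= q^{⟨ρ, a⟩}`).

## References
* [cite: BruhatTits1972, Prop. (4.4.4) (i), (ii), p. 80] — F. Bruhat, J. Tits, Groupes réductifs sur un corps local I,
  Publ. Math. IHÉS 41 (1972), 5–251.
* [cite: CartierCorvallis1979, §IV, Thm. 4.1 and its proof (c)] — P. Cartier, Representations of p-adic groups: a survey,
  Proc. Sympos. Pure Math. 33 (1979), part 1, 111–155.
* [cite: AndrianovZhuravlev1995, Ch. 3 §3 Lemma 3.4, Lemma 3.6, §3.3 Thm. 3.30] — A. N. Andrianov, V. G. Zhuravlev, Modular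
  forms and Hecke operators, Transl. Math. Monogr. 145, AMS 1995.
* [cite: Macdonald1995, Ch. II §1; Ch. V (2.6)] — I. G. Macdonald, Symmetric functions and Hall polynomials, 2nd ed., 1995.
-/

noncomputable section

open scoped Valued WithZero MatrixGroups
open Matrix MulAction

namespace Literature.NumberTheory.Automorphic.SymplecticCartan

open Literature.NumberTheory.Automorphic.CartanUnique Literature.NumberTheory.Automorphic.HermitianLattice

variable {K : Type*} [Field K] [Valued K ℤᵐ⁰] {ϖ : K} {n : ℕ}

/-! ## §1 Linear algebra: unit-determinant integral matrices; the `inl`-block of a symplectic block-triangular matrix -/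

omit [Valued K ℤᵐ⁰] in
/-- **`A Dᵀ = 1` for a symplectic matrix `(A 0; C D)`** (with respect to Mathlib's `J = (0 -1; 1 0)`): the `inl`-block of a
symplectic matrix whose `(inl, inr)`-block vanishes is the inverse transpose of its `inr`-block.
[cite: AndrianovZhuravlev1995, Ch. 1 §3 Prop. 3.7; Ch. 3 §3 Lemma 3.4] -/
theorem toBlocks₁₁_mul_transpose_toBlocks₂₂_eq_one {l : Type*} [Fintype l] [DecidableEq l]
    {M : Matrix (l ⊕ l) (l ⊕ l) K} (hM : M ∈ Matrix.symplecticGroup l K) (h0 : ∀ i j, M (Sum.inl i) (Sum.inr j) = 0) :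
    M.toBlocks₁₁ * M.toBlocks₂₂ᵀ = 1 := by
  have hB : M.toBlocks₁₂ = 0 := by
    ext i j
    exact h0 i j
  have hM' := SymplecticGroup.mem_iff.1 hM
  rw [← Matrix.fromBlocks_toBlocks M, hB, Matrix.fromBlocks_transpose, Matrix.J, Matrix.fromBlocks_multiply,
    Matrix.fromBlocks_multiply] at hM'
  simp only [Matrix.transpose_zero, Matrix.mul_zero, Matrix.zero_mul, add_zero, zero_add, Matrix.mul_one,
    Matrix.mul_neg, Matrix.neg_mul] at hM'
  obtain ⟨-, h12, -, -⟩ := Matrix.fromBlocks_inj.1 hM'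
  exact neg_injective h12

/-- **An integral matrix whose determinant is a unit of `𝒪` has an integral inverse** (`M⁻¹ = (det M)⁻¹ adj M`).
[cite: Macdonald1995, Ch. II §1] -/
theorem v_inv_apply_le_one_of_v_det_eq_one {ι : Type*} [Fintype ι] [DecidableEq ι] {M : Matrix ι ι K}
    (hM : ∀ i j, Valued.v (M i j) ≤ 1) (hdet : Valued.v M.det = 1) (i j : ι) : Valued.v (M⁻¹ i j) ≤ 1 := by
  rw [Matrix.inv_def, Ring.inverse_eq_inv, Matrix.smul_apply, smul_eq_mul, map_mul, map_inv₀, hdet, inv_one, one_mul]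
  exact v_adjugate_apply_le_one hM i j

omit [Valued K ℤᵐ⁰] in
/-- Splitting off the last term of a head sum: `∑_{j<i+1} f_j = ∑_{j<i} f_j + f_i`. [cite: BruhatTits1972, Prop. (4.4.4)] -/
theorem sum_ite_lt_succ_eq (f : Fin n → ℤ) (i : Fin n) :
    (∑ j : Fin n, if (j : ℕ) < (i : ℕ) + 1 then f j else 0) = (∑ j : Fin n, if (j : ℕ) < (i : ℕ) then f j else 0) + f i := by
  have h : ∀ j : Fin n, (if (j : ℕ) < (i : ℕ) + 1 then f j else 0) =
      (if (j : ℕ) < (i : ℕ) then f j else 0) + if j = i then f j else 0 := by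
    intro j
    by_cases hji : j = i
    · subst hji
      rw [if_pos (Nat.lt_succ_self _), if_neg (lt_irrefl _), if_pos rfl, zero_add]
    · have hne : (j : ℕ) ≠ (i : ℕ) := fun h => hji (Fin.ext h)
      by_cases hlt : (j : ℕ) < (i : ℕ)
      · rw [if_pos (by omega), if_pos hlt, if_neg hji, add_zero]
      · rw [if_neg (by omega), if_neg hlt, if_neg hji, add_zero]
  rw [Finset.sum_congr rfl fun j _ => h j, Finset.sum_add_distrib, Finset.sum_ite_eq' Finset.univ i,
    if_pos (Finset.mem_univ _)]

/-! ## §2 The minors of a Borel element on the first `i+1` rows `inr 0, …, inr i` and the columns `inr 0, …, inr (i-1), y` -/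

omit [Valued K ℤᵐ⁰] in
/-- **Row-initial minors of a Borel element**: for `p ∈ B(K)` (upper triangular for the Borel order `inr 0 < ⋯ < inr (n-1) <
inl (n-1) < ⋯ < inl 0`), the minor on the rows `inr 0, …, inr i` and the columns `inr 0, …, inr (i-1), y` is
`(∏_{l<i} p_{inr l, inr l}) · p_{inr i, y}` — the submatrix is again upper triangular. [cite: BruhatTits1972, Prop. (4.4.4)]
[cite: Macdonald1995, Ch. II §1] -/
theorem det_submatrix_inr_snoc_of_mem_symplecticBorel {p : symplecticGroup (Fin n) K} (hp : p ∈ symplecticBorel n K)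
    (i : Fin n) (y : Fin n ⊕ Fin n) :
    ((p : Matrix (Fin n ⊕ Fin n) (Fin n ⊕ Fin n) K).submatrix
        (fun l : Fin ((i : ℕ) + 1) => (Sum.inr (⟨l, by omega⟩ : Fin n) : Fin n ⊕ Fin n))
        (fun l : Fin ((i : ℕ) + 1) => if (l : ℕ) < (i : ℕ) then (Sum.inr (⟨l, by omega⟩ : Fin n) : Fin n ⊕ Fin n) else y)).det =
      (∏ l : Fin (i : ℕ), (p : Matrix (Fin n ⊕ Fin n) (Fin n ⊕ Fin n) K) (Sum.inr ⟨l, by omega⟩) (Sum.inr ⟨l, by omega⟩)) *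
        (p : Matrix (Fin n ⊕ Fin n) (Fin n ⊕ Fin n) K) (Sum.inr i) y := by
  obtain ⟨-, h₂, -⟩ := (blockTriangular_symplecticBorelOrder_iff _).1 (mem_symplecticBorel_iff.1 hp)
  have htri : ((p : Matrix (Fin n ⊕ Fin n) (Fin n ⊕ Fin n) K).submatrix
      (fun l : Fin ((i : ℕ) + 1) => (Sum.inr (⟨l, by omega⟩ : Fin n) : Fin n ⊕ Fin n))
      (fun l : Fin ((i : ℕ) + 1) =>
        if (l : ℕ) < (i : ℕ) then (Sum.inr (⟨l, by omega⟩ : Fin n) : Fin n ⊕ Fin n) else y)).BlockTriangular id := by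
    intro l l' hll'
    have hlt : (l' : ℕ) < (l : ℕ) := hll'
    have hl' : (l' : ℕ) < (i : ℕ) := by have := l.isLt; omega
    rw [Matrix.submatrix_apply, if_pos hl']
    exact h₂ _ _ (Fin.lt_def.2 hlt)
  rw [Matrix.det_of_upperTriangular htri, Fin.prod_univ_castSucc]
  congr 1
  · refine Finset.prod_congr rfl fun l _ => ?_
    rw [Matrix.submatrix_apply, if_pos (by rw [Fin.val_castSucc]; exact l.isLt)]
    simp only [Fin.val_castSucc]
  · rw [Matrix.submatrix_apply, if_neg (by rw [Fin.val_last]; exact lt_irrefl _)]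
    simp only [Fin.val_last, Fin.eta]

/-! ## §3 (4.4.4) (ii): a coset of `K₀ d(a) K₀` with exponents `a` is `d(a) K₀` -/

/-- **Entry bound**: if `g = p k ∈ K₀ d(a) K₀` (`p ∈ B(K)`, `k ∈ K₀`, `a` antitone) has Iwasawa exponents `a(g) = a`, then
`|p_{inr i, y}| ≤ |ϖ^{-a_i}| = exp(a_i)` for every column `y` — the `(i+1) × (i+1)` minors of `p` are bounded by the product
of the `i+1` largest entries `exp(a_0), …, exp(a_i)` of `d(a)`, and the row-initial minor is `(∏_{l<i} p_{inr l, inr l}) p_{inr i, y}`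
with `|p_{inr l, inr l}| = exp(a_l)`. [cite: BruhatTits1972, Prop. (4.4.4) (ii)] [cite: Macdonald1995, Ch. II §1, Ch. V (2.6)] -/
theorem v_apply_inr_le_of_symplecticIwasawaExp_eq (hϖ : Valued.v ϖ = WithZero.exp (-1 : ℤ)) {a : Fin n → ℕ}
    (ha : Antitone a) {g p k : symplecticGroup (Fin n) K} (hp : p ∈ symplecticBorel n K) (hk : k ∈ symplecticInt (Fin n) K)
    (hpk : g = p * k)
    (hg : (g : symplecticGroup (Fin n) K ⧸ symplecticInt (Fin n) K) ∈ MulAction.orbit (symplecticInt (Fin n) K)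
      ((⟨Matrix.diagonal (Sum.elim (fun i => ϖ ^ a i) (fun i => (ϖ ^ a i)⁻¹)),
          diagonal_pow_mem_symplecticGroup (CartanUnique.uniformizer_ne_zero hϖ) a⟩ : symplecticGroup (Fin n) K) :
        symplecticGroup (Fin n) K ⧸ symplecticInt (Fin n) K))
    (he : symplecticIwasawaExp hϖ g = fun i => (a i : ℤ)) (i : Fin n) (y : Fin n ⊕ Fin n) :
    Valued.v ((p : Matrix (Fin n ⊕ Fin n) (Fin n ⊕ Fin n) K) (Sum.inr i) y) ≤ WithZero.exp ((a i : ℕ) : ℤ) := by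
  obtain ⟨A, hA, B, hB, hgAB⟩ := (heckeAlgebra.coe_mem_orbit_coe_iff (symplecticInt (Fin n) K) _ _).1 hg
  -- `p = A · d(a) · B · k⁻¹` as matrices
  have hmat : (p : Matrix (Fin n ⊕ Fin n) (Fin n ⊕ Fin n) K) =
      (A : Matrix (Fin n ⊕ Fin n) (Fin n ⊕ Fin n) K) * Matrix.diagonal (Sum.elim (fun i => ϖ ^ a i) (fun i => (ϖ ^ a i)⁻¹)) *
        (B : Matrix (Fin n ⊕ Fin n) (Fin n ⊕ Fin n) K) *
          ((k⁻¹ : symplecticGroup (Fin n) K) : Matrix (Fin n ⊕ Fin n) (Fin n ⊕ Fin n) K) := by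
    have hpk' : p = g * k⁻¹ := by rw [hpk, mul_inv_cancel_right]
    rw [hpk', hgAB, Submonoid.coe_mul, Submonoid.coe_mul, Submonoid.coe_mul]
  have hmin := v_minor_le_of_eq_mul_diagonal_mul (prod_v_cartanDiagonal_le hϖ ha) (mem_symplecticInt_iff.1 hA)
    (mem_symplecticInt_iff.1 hB) (mem_symplecticInt_iff.1 ((symplecticInt (Fin n) K).inv_mem hk)) hmat
    (fun l : Fin ((i : ℕ) + 1) => (Sum.inr (⟨l, by omega⟩ : Fin n) : Fin n ⊕ Fin n))
    (fun l : Fin ((i : ℕ) + 1) => if (l : ℕ) < (i : ℕ) then (Sum.inr (⟨l, by omega⟩ : Fin n) : Fin n ⊕ Fin n) else y)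
  rw [det_submatrix_inr_snoc_of_mem_symplecticBorel hp i y, map_mul, map_prod] at hmin
  simp_rw [v_apply_inr_eq_exp hϖ hp hk hpk, he] at hmin
  -- `∏_{l<i} exp(a_l) = exp(∑_{l<i} a_l)` and `∑_{j<i+1} a_j = ∑_{l<i} a_l + a_i`
  have hprod : ∏ l : Fin (i : ℕ), WithZero.exp (((a ⟨l, by omega⟩ : ℕ) : ℤ)) =
      WithZero.exp (∑ l : Fin (i : ℕ), ((a ⟨l, by omega⟩ : ℕ) : ℤ)) := by
    have h := prod_exp_neg_eq Finset.univ (fun l : Fin (i : ℕ) => -(((a ⟨l, by omega⟩ : ℕ) : ℤ)))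
    simpa only [neg_neg, Finset.sum_neg_distrib] using h
  have hsplit : (((∑ j : Fin n, if (j : ℕ) < (i : ℕ) + 1 then a j else 0 : ℕ)) : ℤ) =
      (∑ l : Fin (i : ℕ), ((a ⟨l, by omega⟩ : ℕ) : ℤ)) + (a i : ℤ) := by
    rw [natCast_headSum, sum_ite_lt_succ_eq (fun j => (a j : ℤ)) i, sum_first_eq_sum_ite i.isLt.le (fun j => (a j : ℤ))]
  rw [hprod, hsplit, WithZero.exp_add] at hmin
  have h := mul_le_mul_right hmin (WithZero.exp (-(∑ l : Fin (i : ℕ), ((a ⟨l, by omega⟩ : ℕ) : ℤ))))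
  rwa [← mul_assoc, ← mul_assoc, ← WithZero.exp_add, neg_add_cancel, WithZero.exp_zero, one_mul, one_mul] at h

/-- **BRUHAT–TITS (4.4.4) (ii) FOR `Sp_{2n}`** («`K.t.K ∩ B̂⁰.t.K = t.K`»): a coset `gK₀ ⊆ K₀ d(a) K₀`,
`d(a) = diag(ϖ^{a}; ϖ^{-a})`, `a` antitone, whose Iwasawa exponents are `a(g) = a`, IS the coset `d(a) K₀`.  Proof:
`w = d(a)⁻¹ p` (`g = p k`) is integral — its `inr`-rows by the entry bound, its `inr`-diagonal consists of units, and its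
`inl`-block is the inverse transpose of its `inr`-block (`w` is symplectic and block triangular), whose inverse is integral
by the adjugate formula — so `w ∈ K₀` and `gK₀ = pK₀ = d(a) w K₀ = d(a) K₀`.
[cite: BruhatTits1972, Prop. (4.4.4) (ii)] [cite: CartierCorvallis1979, §IV, proof of Thm. 4.1 (c)]
[cite: AndrianovZhuravlev1995, Ch. 3 §3 Lemma 3.6] -/
theorem coe_eq_coe_cartanDiagonal_of_symplecticIwasawaExp_eq (hϖ : Valued.v ϖ = WithZero.exp (-1 : ℤ)) {a : Fin n → ℕ}
    (ha : Antitone a) {g : symplecticGroup (Fin n) K}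
    (hg : (g : symplecticGroup (Fin n) K ⧸ symplecticInt (Fin n) K) ∈ MulAction.orbit (symplecticInt (Fin n) K)
      ((⟨Matrix.diagonal (Sum.elim (fun i => ϖ ^ a i) (fun i => (ϖ ^ a i)⁻¹)),
          diagonal_pow_mem_symplecticGroup (CartanUnique.uniformizer_ne_zero hϖ) a⟩ : symplecticGroup (Fin n) K) :
        symplecticGroup (Fin n) K ⧸ symplecticInt (Fin n) K))
    (he : symplecticIwasawaExp hϖ g = fun i => (a i : ℤ)) :
    (g : symplecticGroup (Fin n) K ⧸ symplecticInt (Fin n) K) =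
      ((⟨Matrix.diagonal (Sum.elim (fun i => ϖ ^ a i) (fun i => (ϖ ^ a i)⁻¹)),
          diagonal_pow_mem_symplecticGroup (CartanUnique.uniformizer_ne_zero hϖ) a⟩ : symplecticGroup (Fin n) K) :
        symplecticGroup (Fin n) K ⧸ symplecticInt (Fin n) K) := by
  have hϖ0 := CartanUnique.uniformizer_ne_zero hϖ
  obtain ⟨p, k, hp, hk, hpk⟩ := exists_mem_symplecticBorel_mul_symplecticInt hϖ g
  -- the inverse diagonal `d' = diag(ϖ^{-a}; ϖ^{a})` and the candidate `w = d' p`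
  have hd' : ∀ i : Fin n, Sum.elim (fun i => (ϖ ^ a i)⁻¹) (fun i => ϖ ^ a i) (Sum.inl i) *
      Sum.elim (fun i => (ϖ ^ a i)⁻¹) (fun i => ϖ ^ a i) (Sum.inr i) = 1 := fun i => by
    rw [Sum.elim_inl, Sum.elim_inr, inv_mul_cancel₀ (pow_ne_zero _ hϖ0)]
  set w : symplecticGroup (Fin n) K :=
    (⟨Matrix.diagonal (Sum.elim (fun i => (ϖ ^ a i)⁻¹) (fun i => ϖ ^ a i)), diagonal_mem_symplecticGroup hd'⟩ :
      symplecticGroup (Fin n) K) * p with hw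
  have hDw : ((⟨Matrix.diagonal (Sum.elim (fun i => ϖ ^ a i) (fun i => (ϖ ^ a i)⁻¹)),
      diagonal_pow_mem_symplecticGroup hϖ0 a⟩ : symplecticGroup (Fin n) K)) * w = p := by
    refine Subtype.ext ?_
    rw [hw, ← mul_assoc, Submonoid.coe_mul, Submonoid.coe_mul, Matrix.diagonal_mul_diagonal]
    have h1 : Sum.elim (fun i => ϖ ^ a i) (fun i => (ϖ ^ a i)⁻¹) * Sum.elim (fun i => (ϖ ^ a i)⁻¹) (fun i => ϖ ^ a i) = 1 := by
      funext x
      rcases x with i | i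
      · simp only [Pi.mul_apply, Sum.elim_inl, Pi.one_apply, mul_inv_cancel₀ (pow_ne_zero _ hϖ0)]
      · simp only [Pi.mul_apply, Sum.elim_inr, Pi.one_apply, inv_mul_cancel₀ (pow_ne_zero _ hϖ0)]
    rw [show (fun x => Sum.elim (fun i => ϖ ^ a i) (fun i => (ϖ ^ a i)⁻¹) x * Sum.elim (fun i => (ϖ ^ a i)⁻¹) (fun i => ϖ ^ a i) x) =
      Sum.elim (fun i => ϖ ^ a i) (fun i => (ϖ ^ a i)⁻¹) * Sum.elim (fun i => (ϖ ^ a i)⁻¹) (fun i => ϖ ^ a i) from rfl, h1,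
      show (1 : Fin n ⊕ Fin n → K) = fun _ => 1 from rfl, Matrix.diagonal_one, Matrix.one_mul]
  -- `w ∈ B(K)`: entries `w_{x, y} = d'_x p_{x, y}`
  have hwB : w ∈ symplecticBorel n K :=
    (symplecticBorel n K).mul_mem (mem_symplecticBorel_iff.2 (Matrix.blockTriangular_diagonal _)) hp
  obtain ⟨hw₁, hw₂, -⟩ := (blockTriangular_symplecticBorelOrder_iff _).1 (mem_symplecticBorel_iff.1 hwB)
  have hwapply : ∀ x y, (w : Matrix (Fin n ⊕ Fin n) (Fin n ⊕ Fin n) K) x y =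
      Sum.elim (fun i => (ϖ ^ a i)⁻¹) (fun i => ϖ ^ a i) x * (p : Matrix (Fin n ⊕ Fin n) (Fin n ⊕ Fin n) K) x y := fun x y => by
    rw [hw, Submonoid.coe_mul, Matrix.diagonal_mul]
  -- (1) the `inr`-rows of `w` are integral
  have hinr : ∀ i y, Valued.v ((w : Matrix (Fin n ⊕ Fin n) (Fin n ⊕ Fin n) K) (Sum.inr i) y) ≤ 1 := fun i y => by
    rw [hwapply, Sum.elim_inr, map_mul, v_uniformizer_pow hϖ]
    calc WithZero.exp (-((a i : ℕ) : ℤ)) * Valued.v ((p : Matrix (Fin n ⊕ Fin n) (Fin n ⊕ Fin n) K) (Sum.inr i) y)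
        ≤ WithZero.exp (-((a i : ℕ) : ℤ)) * WithZero.exp ((a i : ℕ) : ℤ) :=
          mul_le_mul_right (v_apply_inr_le_of_symplecticIwasawaExp_eq hϖ ha hp hk hpk hg he i y) _
      _ = 1 := by rw [← WithZero.exp_add, neg_add_cancel, WithZero.exp_zero]
  -- (2) the `inr`-diagonal of `w` consists of units
  have hdiag : ∀ i, Valued.v ((w : Matrix (Fin n ⊕ Fin n) (Fin n ⊕ Fin n) K) (Sum.inr i) (Sum.inr i)) = 1 := fun i => by
    rw [hwapply, Sum.elim_inr, map_mul, v_uniformizer_pow hϖ, v_apply_inr_eq_exp hϖ hp hk hpk i, he, ← WithZero.exp_add,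
      neg_add_cancel, WithZero.exp_zero]
  -- (3) the `inl`-block of `w` is `(U_wᵀ)⁻¹`, `U_w` the (integral, upper triangular, unit-diagonal) `inr`-block
  have hLU := toBlocks₁₁_mul_transpose_toBlocks₂₂_eq_one w.2 hw₁
  have hU1 : ∀ i j, Valued.v ((w : Matrix (Fin n ⊕ Fin n) (Fin n ⊕ Fin n) K).toBlocks₂₂ᵀ i j) ≤ 1 := fun i j => by
    rw [Matrix.transpose_apply]
    exact hinr j (Sum.inr i)
  have hUtri : ((w : Matrix (Fin n ⊕ Fin n) (Fin n ⊕ Fin n) K).toBlocks₂₂).BlockTriangular id := fun i j hij => hw₂ i j hij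
  have hUdet : Valued.v ((w : Matrix (Fin n ⊕ Fin n) (Fin n ⊕ Fin n) K).toBlocks₂₂ᵀ).det = 1 := by
    rw [Matrix.det_transpose, Matrix.det_of_upperTriangular hUtri, map_prod]
    exact Finset.prod_eq_one fun i _ => hdiag i
  have hL : ∀ i j, Valued.v ((w : Matrix (Fin n ⊕ Fin n) (Fin n ⊕ Fin n) K) (Sum.inl i) (Sum.inl j)) ≤ 1 := fun i j => by
    have h := v_inv_apply_le_one_of_v_det_eq_one hU1 hUdet i j
    rwa [Matrix.inv_eq_left_inv hLU] at h
  -- (4) `w ∈ K₀`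
  have hwK : w ∈ symplecticInt (Fin n) K := by
    refine mem_symplecticInt_iff.2 ?_
    rintro (i | i) y
    · rcases y with j | j
      · exact hL i j
      · rw [hw₁ i j, map_zero]
        exact zero_le
    · exact hinr i y
  -- (5) `gK₀ = pK₀ = d(a) w K₀ = d(a) K₀`
  rw [hpk, QuotientGroup.mk_mul_of_mem p hk, ← hDw, QuotientGroup.mk_mul_of_mem _ hwK]

/-- (4.4.4) (ii) on cosets: `γ ⊆ K₀ d(a) K₀` with `a(γ) = a` is `γ = d(a)K₀` (`a` antitone).
[cite: BruhatTits1972, Prop. (4.4.4) (ii)] -/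
theorem eq_coe_cartanDiagonal_of_mem_orbit_of_symplecticIwasawaExp_out_eq (hϖ : Valued.v ϖ = WithZero.exp (-1 : ℤ))
    {a : Fin n → ℕ} (ha : Antitone a) {γ : symplecticGroup (Fin n) K ⧸ symplecticInt (Fin n) K}
    (hγ : γ ∈ MulAction.orbit (symplecticInt (Fin n) K)
      ((⟨Matrix.diagonal (Sum.elim (fun i => ϖ ^ a i) (fun i => (ϖ ^ a i)⁻¹)),
          diagonal_pow_mem_symplecticGroup (CartanUnique.uniformizer_ne_zero hϖ) a⟩ : symplecticGroup (Fin n) K) :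
        symplecticGroup (Fin n) K ⧸ symplecticInt (Fin n) K))
    (he : symplecticIwasawaExp hϖ γ.out = fun i => (a i : ℤ)) :
    γ = ((⟨Matrix.diagonal (Sum.elim (fun i => ϖ ^ a i) (fun i => (ϖ ^ a i)⁻¹)),
          diagonal_pow_mem_symplecticGroup (CartanUnique.uniformizer_ne_zero hϖ) a⟩ : symplecticGroup (Fin n) K) :
        symplecticGroup (Fin n) K ⧸ symplecticInt (Fin n) K) := by
  rw [← QuotientGroup.out_eq' γ] at hγ ⊢
  exact coe_eq_coe_cartanDiagonal_of_symplecticIwasawaExp_eq hϖ ha hγ he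

/-- **(UNIQUENESS)** in the shape of the abstract criterion of `CartanIwasawaUniquenessGL` §3: on the Cartan representatives
`D = {d(a) : a antitone}`, a coset of `K₀ t K₀` with the exponents of `t` is `tK₀`. [cite: BruhatTits1972, Prop. (4.4.4) (ii)] -/
theorem eq_coe_of_mem_orbit_cartanDiagonal (hϖ : Valued.v ϖ = WithZero.exp (-1 : ℤ)) :
    ∀ t ∈ {t : symplecticGroup (Fin n) K | ∃ a : Fin n → ℕ, Antitone a ∧
        t = ⟨Matrix.diagonal (Sum.elim (fun i => ϖ ^ a i) (fun i => (ϖ ^ a i)⁻¹)),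
          diagonal_pow_mem_symplecticGroup (CartanUnique.uniformizer_ne_zero hϖ) a⟩},
      ∀ γ ∈ MulAction.orbit (symplecticInt (Fin n) K) (t : symplecticGroup (Fin n) K ⧸ symplecticInt (Fin n) K),
        symplecticIwasawaExp hϖ γ.out = symplecticIwasawaExp hϖ t → γ = (t : symplecticGroup (Fin n) K ⧸ symplecticInt (Fin n) K) := by
  rintro _ ⟨a, ha, rfl⟩ γ hγ he
  rw [symplecticIwasawaExp_diagonal] at he
  exact eq_coe_cartanDiagonal_of_mem_orbit_of_symplecticIwasawaExp_out_eq hϖ ha hγ he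

/-! ## §4 Injectivity of the symplectic Satake transform over every commutative ring -/

variable {R : Type*} [CommRing R]

/-- **THE SATAKE TRANSFORM OF `ℋ(Sp_{2n}(K), Sp_{2n}(𝒪); R)` IS INJECTIVE FOR EVERY COMMUTATIVE RING `R` AND EVERY WEIGHT**
(the tree's `symplecticSatakeTransform_injective` needed a domain of characteristic `0`): the abstract criterion
`IsIwasawaExponent.satakeTransform_injective_of_unique` fed with (CARTAN), (SEPARATION), (DOMINANCE) of
`SymplecticSatakeInjective` and (UNIQUENESS) above. [cite: CartierCorvallis1979, §IV Thm. 4.1 (injectivity half)]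
[cite: BruhatTits1972, Prop. (4.4.4) (i), (ii)] [cite: AndrianovZhuravlev1995, Ch. 3 §3.3 Thm. 3.30] -/
theorem satakeTransform_symplectic_injective_of_commRing (hϖ : Valued.v ϖ = WithZero.exp (-1 : ℤ))
    (w : Multiplicative (Fin n → ℤ) →* R) :
    Function.Injective ((isIwasawaExponent_symplectic (n := n) hϖ).satakeTransform w) :=
  (isIwasawaExponent_symplectic hϖ).satakeTransform_injective_of_unique w
    (φ := fun μ : Fin n → ℤ => toLex (fun r : Fin n => ∑ i : Fin n, if (i : ℕ) < (r : ℕ) + 1 then μ i else 0))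
    (exists_cartanDiagonal_mem_orbit hϖ) (injOn_symplecticIwasawaExp_cartanDiagonal hϖ)
    (symplecticIwasawaExp_eq_or_headSum_lt hϖ) (eq_coe_of_mem_orbit_cartanDiagonal hϖ)

/-- **`symplecticSatakeTransform hϖ q` is injective over every commutative ring `R`**, every `q ∈ Rˣ`.
[cite: CartierCorvallis1979, §IV Thm. 4.1 (injectivity half)] [cite: BruhatTits1972, Prop. (4.4.4) (ii)] -/
theorem symplecticSatakeTransform_injective_of_commRing (hϖ : Valued.v ϖ = WithZero.exp (-1 : ℤ)) (q : Rˣ) :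
    Function.Injective (symplecticSatakeTransform (n := n) (R := R) hϖ q) :=
  satakeTransform_symplectic_injective_of_commRing hϖ (symplecticSatakeWeight q)

/-- Injectivity as a kernel statement: `𝒮_w(T) = 0 ⇒ T = 0`, any commutative `R`.
[cite: CartierCorvallis1979, §IV Thm. 4.1 (injectivity half)] -/
theorem eq_zero_of_satakeTransform_symplectic_eq_zero (hϖ : Valued.v ϖ = WithZero.exp (-1 : ℤ))
    (w : Multiplicative (Fin n → ℤ) →* R)
    {T : heckeAlgebra R (symplecticGroup (Fin n) K) (symplecticInt (Fin n) K)}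
    (hT : (isIwasawaExponent_symplectic (n := n) hϖ).satakeTransform w T = 0) : T = 0 :=
  satakeTransform_symplectic_injective_of_commRing hϖ w (by rw [hT, map_zero])

/-! ## §5 The top coefficient of `𝒮_w(T_{d(a)})` is the unit `w(a)` -/

variable [IsHeckeTriple (⊤ : Submonoid (symplecticGroup (Fin n) K)) (symplecticInt (Fin n) K) (symplecticInt (Fin n) K)]

/-- **Exactly one coset of `K₀ d(a) K₀` has exponents `a`** (`a` antitone). [cite: BruhatTits1972, Prop. (4.4.4) (ii)] -/
theorem card_filter_symplecticIwasawaExp_orbit_eq_one (hϖ : Valued.v ϖ = WithZero.exp (-1 : ℤ)) {a : Fin n → ℕ}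
    (ha : Antitone a)
    [DecidablePred fun γ : symplecticGroup (Fin n) K ⧸ symplecticInt (Fin n) K => symplecticIwasawaExp hϖ γ.out = fun i => (a i : ℤ)] :
    ((finite_orbit_quotient (symplecticInt (Fin n) K)
        ((⟨Matrix.diagonal (Sum.elim (fun i => ϖ ^ a i) (fun i => (ϖ ^ a i)⁻¹)),
          diagonal_pow_mem_symplecticGroup (CartanUnique.uniformizer_ne_zero hϖ) a⟩ : symplecticGroup (Fin n) K))).toFinset.filter
        fun γ => symplecticIwasawaExp hϖ γ.out = fun i => (a i : ℤ)).card = 1 := by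
  rw [Finset.card_eq_one]
  refine ⟨((⟨Matrix.diagonal (Sum.elim (fun i => ϖ ^ a i) (fun i => (ϖ ^ a i)⁻¹)),
      diagonal_pow_mem_symplecticGroup (CartanUnique.uniformizer_ne_zero hϖ) a⟩ : symplecticGroup (Fin n) K) :
        symplecticGroup (Fin n) K ⧸ symplecticInt (Fin n) K), ?_⟩
  ext γ
  rw [Finset.mem_filter, Set.Finite.mem_toFinset, Finset.mem_singleton]
  constructor
  · rintro ⟨hγ, he⟩
    exact eq_coe_cartanDiagonal_of_mem_orbit_of_symplecticIwasawaExp_out_eq hϖ ha hγ he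
  · rintro rfl
    exact ⟨MulAction.mem_orbit_self _, symplecticIwasawaExp_out_cartanDiagonal hϖ a⟩

/-- **The top coefficient of `𝒮_w(T_{d(a)})` is the unit `w(a)`** (`a` antitone; any weight `w`, any commutative ring):
Cartier's «`c(λ, λ) = δ(λ)^{1/2}`», sharpening the tree's `coeff_self_symplecticSatakeTransform_cartanDiagonal_ne_zero`
(`≠ 0` over domains of characteristic `0`). [cite: CartierCorvallis1979, §IV, proof of Thm. 4.1 (c)]
[cite: BruhatTits1972, Prop. (4.4.4) (ii)] -/
theorem coeff_self_satakeTransform_symplectic_cartanDiagonal (hϖ : Valued.v ϖ = WithZero.exp (-1 : ℤ))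
    (w : Multiplicative (Fin n → ℤ) →* R) {a : Fin n → ℕ} (ha : Antitone a) :
    ((isIwasawaExponent_symplectic (n := n) hϖ).satakeTransform w
        (heckeAlgebra.doubleCosetOperator (symplecticInt (Fin n) K)
          (⟨Matrix.diagonal (Sum.elim (fun i => ϖ ^ a i) (fun i => (ϖ ^ a i)⁻¹)),
            diagonal_pow_mem_symplecticGroup (CartanUnique.uniformizer_ne_zero hϖ) a⟩ : symplecticGroup (Fin n) K))).coeff
        (fun i => (a i : ℤ)) = w (Multiplicative.ofAdd fun i => (a i : ℤ)) := by
  rw [← symplecticIwasawaExp_diagonal hϖ a]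
  exact (isIwasawaExponent_symplectic hϖ).coeff_self_satakeTransform_doubleCosetOperator_of_unique w
    (eq_coe_of_mem_orbit_cartanDiagonal hϖ _ ⟨a, ha, rfl⟩)

/-- **The top coefficient of `symplecticSatakeTransform hϖ q (T_{d(a)})` is `q^{⟨ρ, a⟩}`**, `ρ = (n, n-1, …, 1)`.
[cite: CartierCorvallis1979, §IV (4.2), proof of Thm. 4.1 (c)] [cite: AndrianovZhuravlev1995, Ch. 3 §3.3 (3.44)–(3.46)] -/
theorem coeff_self_symplecticSatakeTransform_cartanDiagonal (hϖ : Valued.v ϖ = WithZero.exp (-1 : ℤ)) (q : Rˣ)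
    {a : Fin n → ℕ} (ha : Antitone a) :
    (symplecticSatakeTransform hϖ q (heckeAlgebra.doubleCosetOperator (symplecticInt (Fin n) K)
      (⟨Matrix.diagonal (Sum.elim (fun i => ϖ ^ a i) (fun i => (ϖ ^ a i)⁻¹)),
        diagonal_pow_mem_symplecticGroup (CartanUnique.uniformizer_ne_zero hϖ) a⟩ : symplecticGroup (Fin n) K))).coeff
        (fun i => (a i : ℤ)) = ((q ^ symplecticRhoPairing (fun i => (a i : ℤ)) : Rˣ) : R) := by
  rw [symplecticSatakeTransform_eq, coeff_self_satakeTransform_symplectic_cartanDiagonal hϖ _ ha, symplecticSatakeWeight_ofAdd]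

end Literature.NumberTheory.Automorphic.SymplecticCartan

end
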